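import Mathlib
import Summits.PneNP.PneNP.Theorems.WitnessForgingSatBridgeOracleElim
import Summits.PneNP.PneNP.Theorems.WitnessForgingSatBridgeDefs
import Summits.PneNP.PneNP.Theorems.WitnessForgingSatBridgeCounts
import Summits.PneNP.PneNP.Theorems.WitnessForgingSatBridgeCoin
import Summits.PneNP.PneNP.Theorems.WitnessForgingSatBridgeRounds

/-!
# Route WitnessForging — support item `SatBridge` (stmt-PneNP-2432), part 5: the pointwise lower bound

For a fixed satisfiable CNF `φ` (size `N = |enc φ|`, `n ≤ N` variables) and a solution `y`, the
sampler `samplerJVV` (`WitnessForgingSatBridgeDefs.lean`) outputs `y` with probability at least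
`(1 - 2^{-(P+1)}) · (1 - n·(4/k + 2^n/2^{Lb})) / #Sol φ` (`pointwise_lower`): fibrewise over the
oracle-simulation coins (good with probability `≥ 1 - 2^{-(P+1)}`, `oracle_elimination`; on good
coins the run IS the ideal run, `estOf_congr_of_good`, `foldl_stepJVV_congr`), then block by block
(`rounds_prob_ge`, `step_prob_ge`, accuracy events `accurate_prob_ge` from the Stockmeyer counter),
the per-round factors telescoping to `1/#Sol` (`prod_ratio_telescope`, `prod_lower`,
`step_bound_ge`). Bookkeeping: `length_countQuery_le`, `coinPrefix_le`.
-/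

set_option linter.dupNamespace false -- `Summit.PneNP.PneNP.…`: summit = sub-problem (D-0017)

namespace Summit.PneNP.PneNP.Theorems.SatBridgeJVV

open Literature.Computability.Complexity
open _root_.Computability Polynomial Finset
open Literature.Computability.Complexity.SumcheckMA (cnfE cnfE_eq)

/-! ### Bookkeeping: queries, coin prefixes, accuracy events -/

/-- **The counting queries are short**: for `|w| < n ≤ |x|` and `|u'| ≤ U`, the query
`countQuery ⟨x, w·b⟩ (n-|w|-1) k k u'` has length `≤ 16|x| + 22 + 6k + U`. [folklore] -/
theorem length_countQuery_le (x w u' : List Bool) (b : Bool) (n k U : ℕ) (hw : w.length < n)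
    (hn : n ≤ x.length) (hu : u'.length ≤ U) :
    (countQuery (boolPair x (w ++ [b])) (n - w.length - 1) k k u').length ≤
      16 * x.length + 22 + 6 * k + U := by
  have hlu : ∀ m : ℕ, (unaryEncodeNat m).length = m := fun m => CodeFP.length_unE m
  simp only [countQuery, length_boolPair, hlu, List.length_append, List.length_singleton]
  omega

/-- **The coin prefix read by the counter is short**: for `|w| < n ≤ |x|`,
`c(|⟨x, w·b⟩| + (n-|w|-1) + k + k) ≤ c(4|x| + 3 + 2k)`. [folklore] -/
theorem coinPrefix_le (c : Polynomial ℕ) (x w : List Bool) (b : Bool) (n k : ℕ) (hw : w.length < n)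
    (hn : n ≤ x.length) :
    c.eval ((boolPair x (w ++ [b])).length + (n - w.length - 1) + k + k) ≤
      c.eval (4 * x.length + 3 + 2 * k) :=
  TM2Iter.eval_mono c (by simp only [length_boolPair, List.length_append, List.length_singleton]; omega)

/-- On good oracle-simulation coins the oracle-free estimator IS the ideal one on all short
prefixes. [folklore] -/
theorem estOf_congr_of_good {F Fst : List Bool → List Bool} {c : Polynomial ℕ} {x pad r : List Bool}
    {n k Qm : ℕ} (hgood : ∀ q : List Bool, q.length ≤ Qm → Fst (boolPair q (boolPair pad r)) = F q)
    (hQm : ∀ (w u' : List Bool) (b : Bool), w.length < n →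
      u'.length ≤ c.eval ((boolPair x (w ++ [b])).length + (n - w.length - 1) + k + k) →
      (countQuery (boolPair x (w ++ [b])) (n - w.length - 1) k k u').length ≤ Qm)
    (w : List Bool) (b : Bool) (u : List Bool) (hw : w.length < n) :
    estOf (fun q => Fst (boolPair q (boolPair pad r))) c x n k w b u = estOf F c x n k w b u := by
  unfold estOf
  dsimp only
  rw [hgood _ (hQm w _ b hw (List.length_take_le _ _))]

/-- **The accuracy events are likely.** With the counter of `exists_counter`, for `|w| < n` the
estimate `estOf F c (enc φ) n k w b u` is `(1+1/k)`-accurate for `extCount φ (w·b)` for all but a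
fraction `≤ 1/k` of the blocks `u ∈ {0,1}^U`, as soon as `U` covers the coin prefix. [folklore] -/
theorem accurate_prob_ge {F : List Bool → List Bool} {c : Polynomial ℕ} (φ : CNF ℕ)
    (hcnt : ∀ (w : List Bool) (k : ℕ), 0 < k →
      uniformProb (c.eval ((boolPair (encodingCNF.encode φ) w).length + (φ.numVars - w.length) + k + k))
        {u | ¬ IsApproxCount k (extCount φ w)
          (countEstimate F (boolPair (encodingCNF.encode φ) w) (φ.numVars - w.length) k k u)} ≤
        1 / (k : ℝ))
    {k U : ℕ} (hk : 0 < k) (w : List Bool) (b : Bool)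
    (hU : c.eval ((boolPair (encodingCNF.encode φ) (w ++ [b])).length + (φ.numVars - w.length - 1) + k + k) ≤ U) :
    1 - 1 / (k : ℝ) ≤ uniformProb U {u | IsApproxCount k (extCount φ (w ++ [b]))
      (estOf F c (encodingCNF.encode φ) φ.numVars k w b u)} := by
  set x := encodingCNF.encode φ
  set ℓ := c.eval ((boolPair x (w ++ [b])).length + (φ.numVars - w.length - 1) + k + k) with hℓ
  have h := hcnt (w ++ [b]) k hk
  have hlen : φ.numVars - (w ++ [b]).length = φ.numVars - w.length - 1 := by
    simp only [List.length_append, List.length_singleton]; omega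
  rw [hlen] at h
  have hset : {u : List Bool | IsApproxCount k (extCount φ (w ++ [b])) (estOf F c x φ.numVars k w b u)} =
      {u | u.take ℓ ∈ {u' | IsApproxCount k (extCount φ (w ++ [b]))
        (countEstimate F (boolPair x (w ++ [b])) (φ.numVars - w.length - 1) k k u')}} := by
    ext u; rfl
  rw [hset, uniformProb_take_of_le hU]
  have hc : uniformProb ℓ {u' | IsApproxCount k (extCount φ (w ++ [b]))
      (countEstimate F (boolPair x (w ++ [b])) (φ.numVars - w.length - 1) k k u')} =
      1 - uniformProb ℓ {u' | ¬ IsApproxCount k (extCount φ (w ++ [b]))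
        (countEstimate F (boolPair x (w ++ [b])) (φ.numVars - w.length - 1) k k u')} := by
    rw [← uniformProb_compl]; congr 1; ext u; simp
  rw [hc]
  linarith

/-! ### The pointwise lower bound -/

/-- **Pointwise lower bound on the law of the sampler.** Fix a satisfiable CNF `φ` with `n ≤ N`
(`N = |enc φ|`) and a solution `y`. With the counter `F, c` of `exists_counter`, its oracle-free
version `Fst, τ` of `oracle_elimination`, and size polynomials `kk, Lb, P, T, U` that are large
enough at `N` (counter blocks cover the coin prefixes, simulation coins cover `τ`), the sampler
outputs `y` with probability at least
`(1 - 2^{-(P+1)}) · (1 - n·(4/k + 2^n/2^{Lb})) / #Sol φ`: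
fibrewise over the simulation coins (good with probability `≥ 1 - 2^{-(P+1)}`, on which the run is the
ideal run), then block by block (`rounds_prob_ge`, `step_prob_ge` with the accuracy events of
`accurate_prob_ge`), the per-round factors telescoping to `1/#Sol` (`prod_ratio_telescope`,
`prod_lower`, `step_bound_ge`). [cite: JerrumValiantVazirani1986, §3; AroraBarak2009, §7.4.1] -/
theorem pointwise_lower {F Fst : List Bool → List Bool} {c τ : Polynomial ℕ} (kk Lb P T U : Polynomial ℕ)
    (φ : CNF ℕ)
    (hcnt : ∀ (w : List Bool) (k : ℕ), 0 < k →
      uniformProb (c.eval ((boolPair (encodingCNF.encode φ) w).length + (φ.numVars - w.length) + k + k))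
        {u | ¬ IsApproxCount k (extCount φ w)
          (countEstimate F (boolPair (encodingCNF.encode φ) w) (φ.numVars - w.length) k k u)} ≤
        1 / (k : ℝ))
    (hOE : ∀ (Qm : ℕ) (p : List Bool) (T' : ℕ), τ.eval (Qm + p.length) ≤ T' →
      uniformProb T' {r | ∃ q : List Bool, q.length ≤ Qm ∧ Fst (boolPair q (boolPair p r)) ≠ F q} ≤
        1 / 2 ^ (p.length + 1))
    (hn : φ.numVars ≤ (encodingCNF.encode φ).length)
    (hk : 0 < kk.eval (encodingCNF.encode φ).length)
    (hU : c.eval (4 * (encodingCNF.encode φ).length + 3 + 2 * kk.eval (encodingCNF.encode φ).length) ≤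
      U.eval (encodingCNF.encode φ).length)
    (hT : τ.eval ((16 * (encodingCNF.encode φ).length + 22 + 6 * kk.eval (encodingCNF.encode φ).length +
      U.eval (encodingCNF.encode φ).length) + P.eval (encodingCNF.encode φ).length) ≤
      T.eval (encodingCNF.encode φ).length)
    (hx : (4 : ℝ) / kk.eval (encodingCNF.encode φ).length +
      2 ^ φ.numVars / 2 ^ Lb.eval (encodingCNF.encode φ).length ≤ 1)
    (y : List Bool) (hy : y ∈ Sol φ) :
    (1 - 1 / 2 ^ (P.eval (encodingCNF.encode φ).length + 1)) *
        (1 - φ.numVars * ((4 : ℝ) / kk.eval (encodingCNF.encode φ).length +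
          2 ^ φ.numVars / 2 ^ Lb.eval (encodingCNF.encode φ).length)) / extCount φ [] ≤
      uniformProb (T.eval (encodingCNF.encode φ).length + (encodingCNF.encode φ).length *
          (2 * U.eval (encodingCNF.encode φ).length + Lb.eval (encodingCNF.encode φ).length))
        {ω | samplerJVV Fst c kk Lb P T U (encodingCNF.encode φ) φ.numVars ω = y} := by
  classical
  -- abbreviations (everything is at the fixed size `N = |enc φ|`)
  set x := encodingCNF.encode φ with hx_def
  set N := x.length with hN_def
  set n := φ.numVars with hn_def
  set k := kk.eval N with hk_def
  set Lv := Lb.eval N with hLv_def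
  set Pv := P.eval N with hPv_def
  set Tv := T.eval N with hTv_def
  set Uv := U.eval N with hUv_def
  set Qm := 16 * N + 22 + 6 * k + Uv with hQm_def
  set pad := unaryEncodeNat Pv with hpad_def
  have hpadlen : pad.length = Pv := CodeFP.length_unE Pv
  have hylen : y.length = n := hy.1
  have hkR : (0 : ℝ) < k := by exact_mod_cast hk
  have hak : (0 : ℝ) ≤ 1 - 1 / (k : ℝ) := by
    rw [sub_nonneg, div_le_one hkR]; exact_mod_cast hk
  -- the ideal estimator and its accuracy
  set estI : List Bool → Bool → List Bool → ℕ := estOf F c x n k with hestI_def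
  have hUw : ∀ (w : List Bool) (b : Bool), w.length < n →
      c.eval ((boolPair x (w ++ [b])).length + (n - w.length - 1) + k + k) ≤ Uv := fun w b hw =>
    (coinPrefix_le c x w b n k hw hn).trans hU
  -- extension counts along `y`
  set e : ℕ → ℝ := fun j => (extCount φ (y.take j) : ℝ) with he_def
  have he_pos_nat : ∀ j, 0 < extCount φ (y.take j) := by
    intro j
    rcases le_or_gt j n with hj | hj
    · exact extCount_take_pos hy j hj
    · rw [List.take_of_length_le (by omega)]
      rw [extCount_self hy]; exact Nat.one_pos
  have he_pos : ∀ j, 0 < e j := fun j => by simp only [he_def]; exact_mod_cast he_pos_nat j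
  have he_ne : ∀ j, e j ≠ 0 := fun j => (he_pos j).ne'
  have he_n : e n = 1 := by
    simp only [he_def]
    rw [List.take_of_length_le hylen.le, extCount_self hy]; simp
  have he_le : ∀ j, e j ≤ 2 ^ n := fun j => by
    simp only [he_def]; exact_mod_cast extCount_le_two_pow' φ (y.take j)
  have he_succ_ge : ∀ j, 1 ≤ e (j + 1) := fun j => by
    simp only [he_def]; exact_mod_cast he_pos_nat (j + 1)
  -- the per-round bounds
  set bound : ℕ → ℝ := fun j => (1 - 1 / (k : ℝ)) * ((1 - 1 / (k : ℝ)) *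
    ((e (j + 1) / e j) / (1 + 1 / (k : ℝ)) ^ 2 - 1 / 2 ^ Lv)) with hbound_def
  set B : ℕ → ℝ := fun j => if j < n then max 0 (bound j) else 0 with hB_def
  have hB0 : ∀ j, 0 ≤ B j := fun j => by
    simp only [hB_def]; split_ifs
    · exact le_max_left _ _
    · exact le_rfl
  have hB : ∀ j, B j ≤ uniformProb (2 * Uv + Lv) {blk | stepJVV estI Uv Lv (y.take j) blk = y.take (j + 1)} := by
    intro j
    simp only [hB_def]
    split_ifs with hj
    · refine max_le (uniformProb_nonneg _ _) ?_
      have hjy : j < y.length := by rw [hylen]; exact hj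
      have hwlen : (y.take j).length = j := by rw [List.length_take, min_eq_left hjy.le]
      have hw : (y.take j).length < n := by rw [hwlen]; exact hj
      have htake : y.take (j + 1) = y.take j ++ [y.getD j false] := by
        rw [List.take_add_one, List.getD_eq_getElem?_getD, List.getElem?_eq_getElem hjy]
        rfl
      have hcb : ∀ b' : Bool, cond b' (extCount φ (y.take j ++ [true])) (extCount φ (y.take j ++ [false])) =
          extCount φ (y.take j ++ [b']) := fun b' => by cases b' <;> rfl
      have hsum : extCount φ (y.take j ++ [false]) + extCount φ (y.take j ++ [true]) = extCount φ (y.take j) :=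
        (extCount_split φ hw).symm
      have hcpos : 0 < cond (y.getD j false) (extCount φ (y.take j ++ [true])) (extCount φ (y.take j ++ [false])) := by
        rw [hcb, ← htake]; exact he_pos_nat (j + 1)
      have h₀ := accurate_prob_ge φ hcnt hk (y.take j) false (hUw _ false hw)
      have h₁ := accurate_prob_ge φ hcnt hk (y.take j) true (hUw _ true hw)
      have hstep := step_prob_ge estI Uv Lv k (y.take j) (extCount φ (y.take j ++ [false]))
        (extCount φ (y.take j ++ [true])) (y.getD j false) hcpos hak hak h₀ h₁
      rw [htake, show 2 * Uv + Lv = Uv + (Uv + Lv) by ring]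
      refine le_trans (le_of_eq ?_) hstep
      have hcbR : (cond (y.getD j false) (extCount φ (y.take j ++ [true]) : ℝ) (extCount φ (y.take j ++ [false]) : ℝ)) =
          e (j + 1) := by
        simp only [he_def]
        rw [htake, ← hcb]
        cases y.getD j false <;> rfl
      have hsumR : ((extCount φ (y.take j ++ [false]) : ℝ) + (extCount φ (y.take j ++ [true]) : ℝ)) = e j := by
        simp only [he_def]; exact_mod_cast hsum
      simp only [hbound_def]
      rw [hcbR, hsumR]
    · exact uniformProb_nonneg _ _
  -- all rounds, on the ideal run
  have hrounds := rounds_prob_ge estI Uv Lv y B hB0 hB ((N - n) * (2 * Uv + Lv)) n 0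
  simp only [Nat.zero_add, List.take_zero] at hrounds
  rw [List.take_of_length_le hylen.le, show n * (2 * Uv + Lv) + (N - n) * (2 * Uv + Lv) = N * (2 * Uv + Lv) by
    rw [← Nat.add_mul, Nat.add_sub_cancel' hn]] at hrounds
  -- fibres over the oracle-simulation coins
  have hQmw : ∀ (w u' : List Bool) (b : Bool), w.length < n →
      u'.length ≤ c.eval ((boolPair x (w ++ [b])).length + (n - w.length - 1) + k + k) →
      (countQuery (boolPair x (w ++ [b])) (n - w.length - 1) k k u').length ≤ Qm := fun w u' b hw hu' =>
    length_countQuery_le x w u' b n k Uv hw hn (hu'.trans (hUw w b hw))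
  have hfib : ∀ r : List Bool, r.length = Tv →
      r ∈ {r : List Bool | ∀ q : List Bool, q.length ≤ Qm → Fst (boolPair q (boolPair pad r)) = F q} →
      ∏ j ∈ Finset.range n, B j ≤ uniformProb (N * (2 * Uv + Lv))
        {β | r ++ β ∈ {ω : List Bool | samplerJVV Fst c kk Lb P T U x n ω = y}} := by
    intro r hr hgood
    refine hrounds.trans (BPExp.uniformProb_mono_len fun β hrun _ => ?_)
    simp only [Set.mem_setOf_eq] at hrun hgood ⊢
    have h1 : (r ++ β).take (T.eval x.length) = r := by
      rw [List.take_append_of_le_length hr.ge]; exact List.take_of_length_le hr.le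
    have h2 : (r ++ β).drop (T.eval x.length) = β := by
      rw [show T.eval x.length = r.length from hr.symm, List.drop_left]
    have hagree : ∀ (w : List Bool) (b : Bool) (u : List Bool), w.length < n →
        estOf (fun q => Fst (boolPair q (boolPair pad r))) c x n k w b u = estI w b u :=
      estOf_congr_of_good hgood hQmw
    unfold samplerJVV runJVV
    rw [h1, h2, chunks_take _ _ _ hn, foldl_stepJVV_congr hagree _ [] (by simp)]
    exact hrun
  have hgoodP : 1 - 1 / 2 ^ (Pv + 1) ≤
      uniformProb Tv {r : List Bool | ∀ q : List Bool, q.length ≤ Qm → Fst (boolPair q (boolPair pad r)) = F q} := by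
    have h := hOE Qm pad Tv (by rw [hpadlen]; exact hT)
    rw [hpadlen] at h
    have hc : uniformProb Tv {r : List Bool | ∀ q : List Bool, q.length ≤ Qm → Fst (boolPair q (boolPair pad r)) = F q} =
        1 - uniformProb Tv {r | ∃ q : List Bool, q.length ≤ Qm ∧ Fst (boolPair q (boolPair pad r)) ≠ F q} := by
      rw [← uniformProb_compl]; congr 1; ext r; simp
    rw [hc]; linarith
  have hmain := le_uniformProb_add_of_fibre hfib
  -- the product of the per-round bounds
  set xx : ℝ := (4 : ℝ) / k + 2 ^ n / 2 ^ Lv with hxx_def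
  have hBj : ∀ j < n, e (j + 1) / e j * (1 - xx) ≤ B j := by
    intro j hj
    simp only [hB_def, if_pos hj]
    refine le_trans ?_ (le_max_right _ _)
    have hp : 0 ≤ e (j + 1) / e j := (div_pos (he_pos _) (he_pos _)).le
    have ht : 1 / 2 ^ Lv ≤ e (j + 1) / e j * (2 ^ n / 2 ^ Lv) := by
      have h3 : (0 : ℝ) < 2 ^ Lv := by positivity
      rw [div_mul_div_comm, div_le_div_iff₀ h3 (mul_pos (he_pos j) h3), one_mul]
      have h4 : e j ≤ e (j + 1) * 2 ^ n := (he_le j).trans (le_mul_of_one_le_left (by positivity) (he_succ_ge j))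
      exact mul_le_mul_of_nonneg_right h4 h3.le
    have hx' : 4 * (1 / (k : ℝ)) + 2 ^ n / 2 ^ Lv ≤ 1 := by rw [← div_eq_mul_one_div]; exact hx
    have hsb := step_bound_ge (a := 1 / (k : ℝ)) (e := 2 ^ n / 2 ^ Lv) (p := e (j + 1) / e j) (t := 1 / 2 ^ Lv)
      (by positivity) (by positivity) hp ht hx'
    have hxx' : 1 - xx = 1 - 4 * (1 / (k : ℝ)) - 2 ^ n / 2 ^ Lv := by rw [hxx_def]; ring
    rw [hxx']
    exact hsb
  have hprodB := prod_lower n (fun j => e (j + 1) / e j) B xx hx (fun j => (div_pos (he_pos _) (he_pos _)).le) hBj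
  rw [prod_ratio_telescope e he_ne n, he_n] at hprodB
  -- assemble
  have hprod0 : 0 ≤ ∏ j ∈ Finset.range n, B j := Finset.prod_nonneg fun j _ => hB0 j
  have hε : (0 : ℝ) ≤ 1 - 1 / 2 ^ (Pv + 1) := by
    rw [sub_nonneg, div_le_one (by positivity)]; exact one_le_pow₀ (by norm_num)
  have he0 : e 0 = (extCount φ [] : ℝ) := by simp [he_def]
  calc (1 - 1 / 2 ^ (Pv + 1)) * (1 - (n : ℝ) * xx) / (extCount φ [] : ℝ)
      = (1 - 1 / 2 ^ (Pv + 1)) * (1 / e 0 * (1 - n * xx)) := by rw [he0]; ring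
    _ ≤ (1 - 1 / 2 ^ (Pv + 1)) * ∏ j ∈ Finset.range n, B j := mul_le_mul_of_nonneg_left hprodB hε
    _ ≤ uniformProb Tv {r : List Bool | ∀ q : List Bool, q.length ≤ Qm →
          Fst (boolPair q (boolPair pad r)) = F q} * ∏ j ∈ Finset.range n, B j :=
        mul_le_mul_of_nonneg_right hgoodP hprod0
    _ ≤ _ := hmain


end Summit.PneNP.PneNP.Theorems.SatBridgeJVV
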